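import Literature.AlgebraicGeometry.Frobenioids.ElementaryClauses
import HarnessLib

/-!
# Frobenioids I, Proposition 1.5: elementary Frobenioids are Frobenioids — part 3: clauses
# (iv)–(vii), the theorem, and (iii) (STEP-0 calibration fragment of the abc-iut cell — proof genre)

Mochizuki, *The geometry of Frobenioids I: the general theory*, Kyushu J. Math. **62** (2008)
293–400, §1, Proposition 1.5 "(Elementary Frobenioids are Frobenioids)" and its proof, kurims
text p. 27 [cite: MochizukiFrdI2008, Prop. 1.5]:

> "Let `Φ` be a pre-divisorial monoid on a connected, totally epimorphic category `D`. Then: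
> (i) `F_Φ`, equipped with the natural functor `F_Φ → F_{Φ^char}`, is a Frobenioid of Aut-ample,
> Aut^sub-ample, End-ample, base-trivial, Frobenius-trivial, Frobenius-normalized, and isotropic
> type. … (iii) If all of the monoids in the image of `Φ` are perfect (respectively, group-like),
> then `F_Φ` is of perfect (respectively, group-like) type."

The printed proof (194 words) says that everything "follows immediately from the definitions".
Parts 1–2 (`ElementaryIsos.lean`, `ElementaryClauses.lean`) carry out clauses (i)–(iii) of Def. 1.3;
this part does clauses (iv)–(vii) (factorisations, monicity of pre-steps, units, isotropic hulls),
assembles **Prop. 1.5 (i)** as `isFrobenioid_toChar : PreFrobenioid.IsFrobenioid (toChar Φ)` (with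
`F_Φ` a pre-Frobenioid from `ElementaryPreFrobenioid.lean`), and proves **Prop. 1.5 (iii)**
(perfect / group-like type). Where the text appeals to Prop. 1.4 (i) we use the direct observation
that an isometric pre-step of `F_Φ` is an isomorphism. Cancellation in the `Φ(A)` (integrality) is
used for the uniqueness in (iv)(a) and the monicity in (v)(a); (iii) "perfect" uses only the
bijectivity of the `n`-th power maps. No statement of the paper is strengthened.
-/

namespace Literature.AlgebraicGeometry.Frobenioids

open CategoryTheory Opposite

universe w v v' u u'

namespace ElemFrobenioid

variable {D : Type u} [Category.{v} D] {Φ : Dᵒᵖ ⥤ CommMonCat.{w}}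

section Clauses

/-! ### Proposition 1.5 (i): the clauses of Definition 1.3 for `F_Φ`, continued -/

/-- Def. 1.3 (iv)(a), existence, for `F_Φ`: `(f, Z, n) = (f, 0, 1) ∘ (id, Z, 1) ∘ (id, 0, n)`.
[cite: MochizukiFrdI2008, Prop. 1.5] -/
theorem iv_a_exists (hint : ∀ A : D, IsIntegral (Φ.obj (op A))) {A B : ElemFrobenioid Φ}
    (φ : A ⟶ B) : ∃ (X Y : ElemFrobenioid Φ) (γ : A ⟶ X) (β : X ⟶ Y) (α : Y ⟶ B),
      γ ≫ β ≫ α = φ ∧ PreFrobenioid.IsFrobeniusType (toChar Φ) γ ∧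
        PreFrobenioid.IsPreStep (toChar Φ) β ∧ PreFrobenioid.IsPullbackMorphism (toChar Φ) α := by
  refine ⟨A, A, homMk (𝟙 A.base) 1 (degFr φ), homMk (𝟙 A.base) (Div φ) 1, homMk (Base φ) 1 1, ?_,
    ⟨⟨isCoAngular _, Associates.mk_one⟩, ?_⟩, ⟨rfl, ?_⟩,
    isPullbackMorphism_of_degFr_div hint _ rfl isUnit_one⟩
  · refine Hom.ext ?_ ?_ ?_
    · show 𝟙 A.base ≫ 𝟙 A.base ≫ Base φ = Base φ
      rw [Category.id_comp, Category.id_comp]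
    · show pull Φ (𝟙 A.base) (pull Φ (𝟙 A.base) (1 : Φ.obj (op A.base)) * Div φ ^ ((1 : ℕ+) : ℕ)) *
          (1 : Φ.obj (op A.base)) ^ (((1 : ℕ+) * 1 : ℕ+) : ℕ) = Div φ
      simp only [pull_id, map_one, one_mul, mul_one, PNat.one_coe, pow_one]
    · show degFr φ * (1 * 1) = degFr φ
      rw [mul_one, mul_one]
  · show IsIso (𝟙 A.base)
    infer_instance
  · show IsIso (𝟙 A.base)
    infer_instance

/-- Def. 1.3 (iv)(a), uniqueness up to `(α ∘ δ, δ⁻¹ ∘ β ∘ ε, ε⁻¹ ∘ γ)`, for `F_Φ`.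
[cite: MochizukiFrdI2008, Prop. 1.5] -/
theorem iv_a_unique (hint : ∀ A : D, IsIntegral (Φ.obj (op A))) {A B X Y X' Y' : ElemFrobenioid Φ}
    (φ : A ⟶ B) (γ : A ⟶ X) (β : X ⟶ Y) (α : Y ⟶ B) (γ' : A ⟶ X') (β' : X' ⟶ Y') (α' : Y' ⟶ B)
    (h : γ ≫ β ≫ α = φ) (hγ : PreFrobenioid.IsFrobeniusType (toChar Φ) γ)
    (hβ : PreFrobenioid.IsPreStep (toChar Φ) β) (hα : PreFrobenioid.IsPullbackMorphism (toChar Φ) α)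
    (h' : γ' ≫ β' ≫ α' = φ) (hγ' : PreFrobenioid.IsFrobeniusType (toChar Φ) γ')
    (hβ' : PreFrobenioid.IsPreStep (toChar Φ) β') (hα' : PreFrobenioid.IsPullbackMorphism (toChar Φ) α') :
    ∃ (ε : X ≅ X') (δ : Y ≅ Y'), γ ≫ ε.hom = γ' ∧ β ≫ δ.hom = ε.hom ≫ β' ∧ α = δ.hom ≫ α' := by
  haveI : IsIso (Base γ) := hγ.2
  haveI : IsIso (Base γ') := hγ'.2
  haveI : IsIso (Base β) := hβ.2
  haveI : IsIso (Base β') := hβ'.2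
  haveI : IsCancelMul (Φ.obj (op A.base)) := isIntegral_iff_isCancelMul.mp (hint A.base)
  obtain ⟨uγ, huγ⟩ := toChar_isIsometry_iff.mp hγ.1.2
  obtain ⟨hα1, uα, huα⟩ := degFr_div_of_isPullbackMorphism hα
  obtain ⟨hα1', uα', huα'⟩ := degFr_div_of_isPullbackMorphism hα'
  have hβ1 : degFr β = 1 := hβ.1
  have hβ1' : degFr β' = 1 := hβ'.1
  -- the three components of `h`, `h'`
  have eb : Base γ ≫ Base β ≫ Base α = Base φ := congrArg Hom.base h
  have eb' : Base γ' ≫ Base β' ≫ Base α' = Base φ := congrArg Hom.base h'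
  have en : degFr γ * (degFr β * degFr α) = degFr φ := congrArg Hom.degFr h
  have en' : degFr γ' * (degFr β' * degFr α') = degFr φ := congrArg Hom.degFr h'
  have ed : pull Φ (Base γ) (pull Φ (Base β) (Div α) * Div β ^ (degFr α : ℕ)) *
      Div γ ^ ((degFr β * degFr α : ℕ+) : ℕ) = Div φ := congrArg Hom.div h
  have ed' : pull Φ (Base γ') (pull Φ (Base β') (Div α') * Div β' ^ (degFr α' : ℕ)) *
      Div γ' ^ ((degFr β' * degFr α' : ℕ+) : ℕ) = Div φ := congrArg Hom.div h'
  rw [hβ1, hα1, mul_one, mul_one] at en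
  rw [hβ1', hα1', mul_one, mul_one] at en'
  have hn : degFr γ = degFr γ' := en.trans en'.symm
  rw [hβ1, hα1, mul_one, PNat.one_coe, pow_one, pow_one] at ed
  rw [hβ1', hα1', mul_one, PNat.one_coe, pow_one, pow_one] at ed'
  -- `ε`
  let e : X.base ⟶ X'.base := inv (Base γ) ≫ Base γ'
  haveI : IsIso e := by
    show IsIso (inv (Base γ) ≫ Base γ')
    infer_instance
  let E : Φ.obj (op X.base) := pull Φ (inv (Base γ)) (Div γ' * ↑uγ⁻¹)
  have hE : pull Φ (Base γ) E * Div γ = Div γ' := by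
    show pull Φ (Base γ) (pull Φ (inv (Base γ)) (Div γ' * ↑uγ⁻¹)) * Div γ = Div γ'
    rw [← pull_comp, IsIso.hom_inv_id, pull_id, ← huγ, Units.inv_mul_cancel_right]
  let ε : X ⟶ X' := homMk e E 1
  haveI : IsIso ε :=
    isIso_homMk e (((toChar_isIsometry_iff.mp hγ'.1.2).mul (uγ⁻¹).isUnit).map _)
  have hγε : γ ≫ ε = γ' := by
    refine Hom.ext ?_ ?_ ?_
    · show Base γ ≫ inv (Base γ) ≫ Base γ' = Base γ'
      rw [IsIso.hom_inv_id_assoc]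
    · show pull Φ (Base γ) E * Div γ ^ ((1 : ℕ+) : ℕ) = Div γ'
      rw [PNat.one_coe, pow_one, hE]
    · show degFr γ * 1 = degFr γ'
      rw [mul_one, hn]
  have hγ'b : Base γ' = Base γ ≫ e := by
    show Base γ' = Base γ ≫ inv (Base γ) ≫ Base γ'
    rw [IsIso.hom_inv_id_assoc]
  -- `δ`
  let d : Y.base ⟶ Y'.base := inv (Base β) ≫ e ≫ Base β'
  haveI : IsIso d := by
    show IsIso (inv (Base β) ≫ e ≫ Base β')
    infer_instance
  have hd : d ≫ Base α' = Base α := by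
    show (inv (Base β) ≫ (inv (Base γ) ≫ Base γ') ≫ Base β') ≫ Base α' = Base α
    simp only [Category.assoc]
    rw [← eb.trans eb'.symm, IsIso.inv_hom_id_assoc, IsIso.inv_hom_id_assoc]
  have hbd : Base β ≫ d = e ≫ Base β' := by
    show Base β ≫ inv (Base β) ≫ e ≫ Base β' = e ≫ Base β'
    rw [IsIso.hom_inv_id_assoc]
  let Fd : Φ.obj (op Y.base) := ↑(Units.map (pull Φ d) uα')⁻¹ * Div α
  let δ : Y ⟶ Y' := homMk d Fd 1
  haveI : IsIso δ := isIso_homMk d (((Units.map (pull Φ d) uα')⁻¹).isUnit.mul ⟨uα, huα⟩)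
  have hδα : α = δ ≫ α' := by
    refine Hom.ext hd.symm ?_ ?_
    · show Div α = pull Φ d (Div α') * (↑(Units.map (pull Φ d) uα')⁻¹ * Div α) ^ (degFr α' : ℕ)
      rw [hα1', PNat.one_coe, pow_one, ← huα', ← Units.coe_map, Units.mul_inv_cancel_left]
    · show degFr α = 1 * degFr α'
      rw [one_mul, hα1, hα1']
  -- the key identity behind the middle square
  have e3 : pull Φ (Base β) (Div α) * Div β =
      pull Φ e (pull Φ (Base β') (Div α')) * (pull Φ e (Div β') * E) := by
    rw [hγ'b, ← hE, pull_comp, ← mul_assoc, ← map_mul] at ed'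
    have h₁ := mul_right_cancel (ed.trans ed'.symm)
    have h₂ : pull Φ (Base β) (Div α) * Div β = pull Φ e (pull Φ (Base β') (Div α') * Div β') * E :=
      (pullEquiv Φ (Base γ)).injective h₁
    rw [h₂, map_mul, mul_assoc]
  have hw : pull Φ e (pull Φ (Base β') (Div α')) =
      ↑(Units.map (pull Φ (Base β)) (Units.map (pull Φ d) uα')) := by
    rw [Units.coe_map, Units.coe_map, huα', ← pull_comp, ← pull_comp, hbd]
  refine ⟨asIso ε, asIso δ, hγε, Hom.ext hbd ?_ ?_, hδα⟩
  · show pull Φ (Base β) Fd * Div β ^ ((1 : ℕ+) : ℕ) = pull Φ e (Div β') * E ^ (degFr β' : ℕ)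
    rw [hβ1', PNat.one_coe, pow_one, pow_one]
    show pull Φ (Base β) (↑(Units.map (pull Φ d) uα')⁻¹ * Div α) * Div β = pull Φ e (Div β') * E
    rw [map_mul, mul_assoc, e3, hw, ← Units.coe_map, map_inv, Units.inv_mul_cancel_left]
  · show degFr β * 1 = 1 * degFr β'
    rw [hβ1, hβ1']

/-- Def. 1.3 (iv)(b) for `F_Φ`: pull-back morphisms are LB-invertible and linear.
[cite: MochizukiFrdI2008, Prop. 1.5] -/
theorem iv_b {A B : ElemFrobenioid Φ} (φ : A ⟶ B) (h : PreFrobenioid.IsPullbackMorphism (toChar Φ) φ) :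
    PreFrobenioid.IsLBInvertible (toChar Φ) φ ∧ PreFrobenioid.IsLinear (toChar Φ) φ := by
  obtain ⟨h₁, h₂⟩ := degFr_div_of_isPullbackMorphism h
  exact ⟨⟨isCoAngular φ, toChar_isIsometry_iff.mpr h₂⟩, h₁⟩

/-- Def. 1.3 (v)(a) for `F_Φ`: pre-steps are monomorphisms (cancellation in `Φ`).
[cite: MochizukiFrdI2008, Prop. 1.5] -/
theorem v_a (hint : ∀ A : D, IsIntegral (Φ.obj (op A))) {A B : ElemFrobenioid Φ} (φ : A ⟶ B)
    (h : PreFrobenioid.IsPreStep (toChar Φ) φ) : Mono φ := by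
  haveI : IsIso (Base φ) := h.2
  have h1 : degFr φ = 1 := h.1
  refine ⟨fun {X} g g' e => ?_⟩
  haveI : IsCancelMul (Φ.obj (op X.base)) := isIntegral_iff_isCancelMul.mp (hint X.base)
  have eb : Base g ≫ Base φ = Base g' ≫ Base φ := congrArg Hom.base e
  have ed : pull Φ (Base g) (Div φ) * Div g ^ (degFr φ : ℕ) =
      pull Φ (Base g') (Div φ) * Div g' ^ (degFr φ : ℕ) := congrArg Hom.div e
  have en : degFr g * degFr φ = degFr g' * degFr φ := congrArg Hom.degFr e
  have eb' : Base g = Base g' := (cancel_mono (Base φ)).mp eb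
  rw [eb', h1, PNat.one_coe, pow_one, pow_one] at ed
  exact Hom.ext eb' (mul_left_cancel ed) (mul_right_cancel en)

/-- Def. 1.3 (v)(b), existence, for `F_Φ`: `φ = id ∘ φ`. [cite: MochizukiFrdI2008, Prop. 1.5] -/
theorem v_b_exists {A B : ElemFrobenioid Φ} (φ : A ⟶ B) (h : PreFrobenioid.IsPreStep (toChar Φ) φ) :
    ∃ (X : ElemFrobenioid Φ) (β : A ⟶ X) (α : X ⟶ B), β ≫ α = φ ∧
      PreFrobenioid.IsCoAngularPreStep (toChar Φ) β ∧
        (PreFrobenioid.IsIsometry (toChar Φ) α ∧ PreFrobenioid.IsPreStep (toChar Φ) α) :=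
  ⟨B, φ, 𝟙 B, Category.comp_id φ, ⟨isCoAngular φ, h⟩, isIsometry_id B, isPreStep_id B⟩

/-- Def. 1.3 (v)(b), uniqueness, for `F_Φ` (isometric pre-steps are isomorphisms).
[cite: MochizukiFrdI2008, Prop. 1.5] -/
theorem v_b_unique {A B X X' : ElemFrobenioid Φ} (φ : A ⟶ B) (β : A ⟶ X) (α : X ⟶ B)
    (β' : A ⟶ X') (α' : X' ⟶ B) (e : β ≫ α = φ)
    (_hβ : PreFrobenioid.IsCoAngularPreStep (toChar Φ) β)
    (hα : PreFrobenioid.IsIsometry (toChar Φ) α ∧ PreFrobenioid.IsPreStep (toChar Φ) α)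
    (e' : β' ≫ α' = φ) (_hβ' : PreFrobenioid.IsCoAngularPreStep (toChar Φ) β')
    (hα' : PreFrobenioid.IsIsometry (toChar Φ) α' ∧ PreFrobenioid.IsPreStep (toChar Φ) α') :
    ∃ γ : X ≅ X', β ≫ γ.hom = β' ∧ α = γ.hom ≫ α' := by
  haveI := isIso_of_isIsometry_of_isPreStep hα.1 hα.2
  haveI := isIso_of_isIsometry_of_isPreStep hα'.1 hα'.2
  refine ⟨asIso α ≪≫ (asIso α').symm, ?_, ?_⟩
  · show β ≫ α ≫ inv α' = β'
    rw [← Category.assoc, e, ← e', Category.assoc, IsIso.hom_inv_id, Category.comp_id]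
  · show α = (α ≫ inv α') ≫ α'
    rw [Category.assoc, IsIso.inv_hom_id, Category.comp_id]

/-- Def. 1.3 (v)(c), existence, for `F_Φ`: `φ = φ ∘ id`. [cite: MochizukiFrdI2008, Prop. 1.5] -/
theorem v_c_exists {A B : ElemFrobenioid Φ} (φ : A ⟶ B) (h : PreFrobenioid.IsPreStep (toChar Φ) φ) :
    ∃ (X : ElemFrobenioid Φ) (β' : A ⟶ X) (α' : X ⟶ B), β' ≫ α' = φ ∧
      (PreFrobenioid.IsIsometry (toChar Φ) β' ∧ PreFrobenioid.IsPreStep (toChar Φ) β') ∧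
        PreFrobenioid.IsCoAngularPreStep (toChar Φ) α' :=
  ⟨A, 𝟙 A, φ, Category.id_comp φ, ⟨isIsometry_id A, isPreStep_id A⟩, isCoAngular φ, h⟩

/-- Def. 1.3 (v)(c), uniqueness, for `F_Φ`. [cite: MochizukiFrdI2008, Prop. 1.5] -/
theorem v_c_unique {A B X X' : ElemFrobenioid Φ} (φ : A ⟶ B) (β : A ⟶ X) (α : X ⟶ B)
    (β' : A ⟶ X') (α' : X' ⟶ B) (e : β ≫ α = φ)
    (hβ : PreFrobenioid.IsIsometry (toChar Φ) β ∧ PreFrobenioid.IsPreStep (toChar Φ) β)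
    (_hα : PreFrobenioid.IsCoAngularPreStep (toChar Φ) α) (e' : β' ≫ α' = φ)
    (hβ' : PreFrobenioid.IsIsometry (toChar Φ) β' ∧ PreFrobenioid.IsPreStep (toChar Φ) β')
    (_hα' : PreFrobenioid.IsCoAngularPreStep (toChar Φ) α') :
    ∃ γ : X ≅ X', β ≫ γ.hom = β' ∧ α = γ.hom ≫ α' := by
  haveI := isIso_of_isIsometry_of_isPreStep hβ.1 hβ.2
  haveI := isIso_of_isIsometry_of_isPreStep hβ'.1 hβ'.2
  refine ⟨(asIso β).symm ≪≫ asIso β', ?_, ?_⟩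
  · show β ≫ inv β ≫ β' = β'
    rw [IsIso.hom_inv_id_assoc]
  · show α = (inv β ≫ β') ≫ α'
    rw [Category.assoc, e', ← e, IsIso.inv_hom_id_assoc]

/-- Def. 1.3 (vi) for `F_Φ`: `(b, Z, 1)` and `(b, Z u, 1)` differ by the unit `(id, (b⁻¹)^* u, 1)`.
[cite: MochizukiFrdI2008, Prop. 1.5] -/
theorem vi {A B : ElemFrobenioid Φ} (φ ψ : A ⟶ B)
    (hφ : PreFrobenioid.IsCoAngularPreStep (toChar Φ) φ)
    (hψ : PreFrobenioid.IsCoAngularPreStep (toChar Φ) ψ)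
    (hb : PreFrobenioid.BaseEquivalent (toChar Φ) φ ψ)
    (hm : PreFrobenioid.MetricallyEquivalent (toChar Φ) φ ψ) :
    ∃ α ∈ PreFrobenioid.unitsSubgroup (toChar Φ) B, ψ ≫ α.hom = φ := by
  haveI : IsIso (Base ψ) := hψ.2.2
  have hb' : Base φ = Base ψ := hb
  obtain ⟨u, hu⟩ : Associated (Div φ) (Div ψ) := Associates.mk_eq_mk_iff_associated.mp hm
  let a : B ⟶ B := homMk (𝟙 B.base) (pull Φ (inv (Base ψ)) ↑u⁻¹) 1
  haveI : IsIso a := isIso_homMk _ ((u⁻¹).isUnit.map _)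
  refine ⟨asIso a, show _ ∧ _ from ⟨rfl, rfl⟩, Hom.ext ?_ ?_ ?_⟩
  · show Base ψ ≫ 𝟙 B.base = Base φ
    rw [Category.comp_id, hb']
  · show pull Φ (Base ψ) (pull Φ (inv (Base ψ)) ↑u⁻¹) * Div ψ ^ ((1 : ℕ+) : ℕ) = Div φ
    rw [← pull_comp, IsIso.hom_inv_id, pull_id, PNat.one_coe, pow_one, ← hu, mul_comm (Div φ),
      Units.inv_mul_cancel_left]
  · show degFr ψ * 1 = degFr φ
    rw [mul_one, show degFr ψ = 1 from hψ.2.1, show degFr φ = 1 from hφ.2.1]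

/-- Def. 1.3 (vii)(a) for `F_Φ`: the identity is an isotropic hull. [cite: MochizukiFrdI2008, Prop. 1.5] -/
theorem vii_a (A : ElemFrobenioid Φ) :
    ∃ (B : ElemFrobenioid Φ) (φ : A ⟶ B), PreFrobenioid.IsIsotropicHull (toChar Φ) φ :=
  ⟨A, 𝟙 A, isIsometry_id A, isPreStep_id A, isIsotropic A, fun _ γ _ =>
    ⟨γ, Category.id_comp γ, fun β hβ => (Category.id_comp β).symm.trans hβ⟩⟩

end Clauses

/-! ### Proposition 1.5 (i): `F_Φ` is a Frobenioid -/

/-- **FrdI Proposition 1.5 (i)**: for a pre-divisorial monoid `Φ` on a connected, totally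
epimorphic category `D`, `F_Φ → F_{Φ^char}` is a Frobenioid. [cite: MochizukiFrdI2008, Prop. 1.5] -/
theorem isFrobenioid_toChar (hΦ : IsMonoidOn Φ)
    (hpre : Objectwise (fun M _ => IsPreDivisorial M) Φ) (hDc : IsGraphConnected D)
    (hDe : IsTotallyEpimorphic D) : PreFrobenioid.IsFrobenioid (toChar Φ) :=
  have hint : ∀ A : D, IsIntegral (Φ.obj (op A)) := fun A => (hpre A).isIntegral
  { isPreFrobenioid := isPreFrobenioid_toChar hΦ hpre hDc hDe
    i_a := i_a
    i_b := i_b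
    i_c := i_c hint
    ii_exists := ii_exists
    ii_unique := fun _ _ _ φ ψ hφ hψ hn => ii_unique φ ψ hφ hψ hn
    iii_a := fun _ _ _ f g _ _ => isCoAngular (f ≫ g)
    iii_b := fun _ _ _ _ ψ => isCoAngular ψ
    iii_c := fun _ _ φ h => iii_c φ h
    iii_c_base := fun _ _ φ φ' h h' hb α β β' e₁ e₂ => iii_c_base hint φ φ' h h' hb α β β' e₁ e₂
    iii_d_under_full := fun _ _ _ φ φ' h h' hd => iii_d_under_full φ φ' h h' hd
    iii_d_under_surj := iii_d_under_surj
    iii_d_over_full := fun _ _ _ ψ ψ' h h' hd => iii_d_over_full ψ ψ' h h' hd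
    iii_d_over_surj := iii_d_over_surj
    iv_a_exists := fun _ _ φ => iv_a_exists hint φ
    iv_a_unique := fun _ _ _ _ _ _ φ γ β α γ' β' α' h hγ hβ hα h' hγ' hβ' hα' =>
      iv_a_unique hint φ γ β α γ' β' α' h hγ hβ hα h' hγ' hβ' hα'
    iv_b := fun _ _ φ h => iv_b φ h
    v_a := fun _ _ φ h => v_a hint φ h
    v_b_exists := fun _ _ φ h => v_b_exists φ h
    v_b_unique := fun _ _ _ _ φ β α β' α' e hβ hα e' hβ' hα' =>
      v_b_unique φ β α β' α' e hβ hα e' hβ' hα'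
    v_c_exists := fun _ _ φ h => v_c_exists φ h
    v_c_unique := fun _ _ _ _ φ β α β' α' e hβ hα e' hβ' hα' =>
      v_c_unique φ β α β' α' e hβ hα e' hβ' hα'
    vi := fun _ _ φ ψ hφ hψ hb hm => vi φ ψ hφ hψ hb hm
    vii_a := vii_a
    vii_b := fun _ _ _ _ => isIsotropic _ }

/-! ### Proposition 1.5 (iii): perfect and group-like type -/

/-- **FrdI Prop. 1.5 (iii)**, group-like: if every `Φ(A)` is group-like then `F_Φ` is of group-like
type. [cite: MochizukiFrdI2008, Prop. 1.5] -/
theorem isOfType_isGroupLikeObj (h : Objectwise (fun M _ => IsGroupLike M) Φ) :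
    PreFrobenioid.IsOfType (PreFrobenioid.IsGroupLikeObj (toChar Φ)) :=
  fun A x => @Subsingleton.elim _ (h A.base).subsingleton_associates x 1

/-- **FrdI Prop. 1.5 (iii)**, perfect: if every `Φ(A)` is perfect then `F_Φ` is of perfect type
(the descended pre-step has zero divisor the unique `n`-th root). [cite: MochizukiFrdI2008, Prop. 1.5] -/
theorem isOfPerfectType (hperf : Objectwise (fun M _ => IsPerfect M) Φ) :
    PreFrobenioid.IsOfPerfectType (toChar Φ) := by
  intro A n
  refine ⟨fun B _ => ⟨B, homMk (𝟙 B.base) 1 n, ⟨⟨isCoAngular _, Associates.mk_one⟩,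
    show IsIso (𝟙 B.base) from inferInstance⟩, rfl⟩, ?_⟩
  intro B₁ B₁' B₂ B₂' φ₁ φ₂ _ _ hφ₁ hn₁ hφ₂ hn₂ ψ' hψ'
  haveI : IsIso (Base φ₁) := hφ₁.2
  haveI : IsIso (Base φ₂) := hφ₂.2
  haveI : IsIso (Base ψ') := hψ'.2
  have hn₁' : degFr φ₁ = n := hn₁
  have hn₂' : degFr φ₂ = n := hn₂
  have h1' : degFr ψ' = 1 := hψ'.1
  obtain ⟨u₂, hu₂⟩ := toChar_isIsometry_iff.mp hφ₂.1.2
  let b : B₁.base ⟶ B₂.base := Base φ₁ ≫ Base ψ' ≫ inv (Base φ₂)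
  haveI : IsIso b := by
    show IsIso (Base φ₁ ≫ Base ψ' ≫ inv (Base φ₂))
    infer_instance
  obtain ⟨Z, hZ⟩ : ∃ Z : Φ.obj (op B₁.base),
      Z ^ (n : ℕ) = ↑(Units.map (pull Φ b) u₂)⁻¹ * (pull Φ (Base φ₁) (Div ψ') * Div φ₁) :=
    ((hperf B₁.base).bijective_pow n n.pos).2 _
  refine ⟨homMk b Z 1, ⟨⟨rfl, show IsIso b from inferInstance⟩, Hom.ext ?_ ?_ ?_⟩, ?_⟩
  · show (Base φ₁ ≫ Base ψ' ≫ inv (Base φ₂)) ≫ Base φ₂ = Base φ₁ ≫ Base ψ'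
    simp only [Category.assoc, IsIso.inv_hom_id, Category.comp_id]
  · show pull Φ b (Div φ₂) * Z ^ (degFr φ₂ : ℕ) = pull Φ (Base φ₁) (Div ψ') * Div φ₁ ^ (degFr ψ' : ℕ)
    rw [hn₂', hZ, h1', PNat.one_coe, pow_one, ← hu₂, ← Units.coe_map, Units.mul_inv_cancel_left]
  · show 1 * degFr φ₂ = degFr φ₁ * degFr ψ'
    rw [one_mul, hn₂', hn₁', h1', mul_one]
  · rintro ψ ⟨⟨hψ1, _⟩, he⟩
    have hψ1' : degFr ψ = 1 := hψ1
    have eb : Base ψ ≫ Base φ₂ = Base φ₁ ≫ Base ψ' := congrArg Hom.base he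
    have ed : pull Φ (Base ψ) (Div φ₂) * Div ψ ^ (degFr φ₂ : ℕ) =
        pull Φ (Base φ₁) (Div ψ') * Div φ₁ ^ (degFr ψ' : ℕ) := congrArg Hom.div he
    have hb : Base ψ = b := by
      show Base ψ = Base φ₁ ≫ Base ψ' ≫ inv (Base φ₂)
      rw [← Category.assoc, ← eb, Category.assoc, IsIso.hom_inv_id, Category.comp_id]
    rw [hb, hn₂', h1', PNat.one_coe, pow_one, ← hu₂, ← Units.coe_map] at ed
    have hZψ : Div ψ ^ (n : ℕ) = ↑(Units.map (pull Φ b) u₂)⁻¹ * (pull Φ (Base φ₁) (Div ψ') * Div φ₁) :=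
      (Units.eq_inv_mul_iff_mul_eq _).mpr ed
    have hdiv : Div ψ = Z := ((hperf B₁.base).bijective_pow n n.pos).1 (hZψ.trans hZ.symm)
    exact Hom.ext hb hdiv hψ1'

end ElemFrobenioid

end Literature.AlgebraicGeometry.Frobenioids
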